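import Literature.MathematicalPhysics.QuantumLattice.GermMarkovSpectralCriterion
import Literature.Probability.Distributions.GaussianSplitting
import Mathlib.Analysis.Calculus.BumpFunction.InnerProduct
import HarnessLib

/-!
# Rozanov's spectral criterion, proof part I: the collar Markov property splits the Gaussian space

Topic `MathematicalPhysics/QuantumLattice`; first proof file for the named fact
`InvSpectralDensityPolynomialOfCollarMarkov` (file `GermMarkovSpectralCriterion`; Yu. A. Rozanov,
*Markov Random Fields* (1982), Ch. 3 §2.3 Theorem, necessity half).  THEOREM-ONLY file.

For a centred Gaussian law `μ` on field configurations `FieldConfig E = 𝓢'(E)` the evaluation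
process `X_f(ω) = ω(f)`, `f ∈ 𝓢(E, ℝ)`, is a centred real Gaussian process
(`IsGaussianField.isGaussianProcess_eval`), its region σ-algebras `fieldSigma U` are the
σ-algebras `σ(X_J)`, `J = {f : tsupport f ⊆ U}` (`fieldSigma_eq_subfamilySigma`), and its Gaussian
spaces are the closed spans `H(U) = gaussianSpan _ {f : tsupport f ⊆ U} ⊆ L²(μ)`.  This file
transports Rozanov's wide-sense Markov property to this setting:

* `exists_schwartz_decomp_collar` — **additivity** (Rozanov Ch. 2 §3.1 (3.1),
  `H(S' ∪ S'') = H(S') ∨ H(S'')`, for the cover of `E` by the open ball `B(0, r)`, the open collar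
  `(∂B)^ε` and the open exterior `B̄ᶜ`): every real test function splits as `w = w₁ + w₂ + w₃`
  with `tsupport w₁ ⊆ B(0, r)`, `tsupport w₂ ⊆ (∂B(0,r))^ε`, `tsupport w₃ ⊆ B̄(0, r)ᶜ` (two smooth
  radial cutoffs, Mathlib's `ContDiffBump`);
* `gaussianSpan_univ_le_closure_sup` — hence the whole Gaussian space `H(E)` is the closure of
  `H(B) + H((∂B)^ε) + H(B̄ᶜ)`;
* `inner_eq_zero_of_collar_condIndepCondExp` — **Rozanov's (3.10)**: if the collar σ-algebra
  `𝒜((∂B)^ε)` splits `𝒜(B)` and `𝒜(B̄ᶜ)` (`CondIndepCondExp`, the condition inside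
  `IsCollarMarkovAt μ B`), then any `x ∈ H(E)` orthogonal to `H((∂B)^ε)` and to `H(B̄ᶜ)` is
  orthogonal to any `y` orthogonal to `H((∂B)^ε)` and to `H(B)` — i.e.
  `H(B ∪ Γ^ε)^⊥ ⊥ H(B̄ᶜ ∪ Γ^ε)^⊥` — via the Gaussian splitting theorem
  `Literature.Probability.Distributions.inner_eq_zero_of_condIndepCondExp_of_mem_orthogonal`
  (Rozanov (3.3), (3.6)–(3.7); Janson Thm 9.1).

## References

* Yu. A. Rozanov, *Markov Random Fields*, Springer (1982), Ch. 2 §3.1 (3.1), (3.3), §3.3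
  (3.10). [Rozanov1982]

## Mathlib / tree

`ContDiffBump`, `HasCompactSupport.hasTemperateGrowth`, `SchwartzMap.smulLeftCLM`,
`SchwartzMap.tsupport_smulLeftCLM_subset`, `Metric.mem_thickening_iff`; the tree's
`gaussianSpan`, `subfamilySigma`, `condExp`-free splitting predicate `CondIndepCondExp`,
`IsGaussianField.hasGaussianLaw_eval`-style packaging of evaluations as continuous linear maps
(`PointwiseConvergenceCLM.evalCLM`).  No new definitions.
-/

noncomputable section

open MeasureTheory ProbabilityTheory Filter Metric Set
open scoped Topology InnerProductSpace ENNReal SchwartzMap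
open Literature.Probability.Distributions

namespace Literature.MathematicalPhysics.QuantumLattice

/-! ### The evaluation process of a Gaussian field -/

section Eval

variable {E : Type*} [NormedAddCommGroup E] [NormedSpace ℝ E]

/-- **The evaluation process of a centred Gaussian field is a real Gaussian process**: all
finite-dimensional marginals `ω ↦ (ω f)_{f ∈ I}` are Gaussian, being images of the Gaussian law
`μ` under continuous linear maps (Glimm–Jaffe §6.2 (6.2.4)). [folklore] -/
theorem IsGaussianField.isGaussianProcess_eval {μ : Measure (FieldConfig E)} (hμ : IsGaussianField μ) :
    IsGaussianProcess (fun (f : 𝓢(E, ℝ)) (ω : FieldConfig E) => ω f) μ := by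
  obtain ⟨hG, -⟩ := hμ
  refine ⟨fun I => ?_⟩
  set L : FieldConfig E →L[ℝ] (I → ℝ) :=
    ContinuousLinearMap.pi fun f : I =>
      (PointwiseConvergenceCLM.evalCLM (RingHom.id ℝ) ℝ (f : 𝓢(E, ℝ)) : StrongDual ℝ (FieldConfig E))
    with hL
  have hLm : Measurable L := L.continuous.measurable
  haveI : IsGaussian (μ.map L) := isGaussian_map_of_measurable hLm
  have hfun : (fun ω : FieldConfig E => I.restrict fun f : 𝓢(E, ℝ) => ω f) =
      (L : FieldConfig E → I → ℝ) := by
    funext ω; funext f; rfl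
  rw [hfun]
  exact IsGaussian.hasGaussianLaw

/-- The region σ-algebra `fieldSigma U` *is* the σ-algebra generated by the sub-family
`{X_f : tsupport f ⊆ U}` of the evaluation process (`subfamilySigma`). [folklore] -/
theorem fieldSigma_eq_subfamilySigma (U : Set E) :
    fieldSigma U =
      subfamilySigma (fun (f : 𝓢(E, ℝ)) (ω : FieldConfig E) => ω f) {f | tsupport f ⊆ U} :=
  rfl

/-- The coordinates of the evaluation process are measurable. [folklore] -/
theorem measurable_eval_process (f : 𝓢(E, ℝ)) :
    Measurable ((fun (f : 𝓢(E, ℝ)) (ω : FieldConfig E) => ω f) f) :=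
  measurable_eval f

/-- The coordinates of the evaluation process of a centred Gaussian field are centred.
[folklore] -/
theorem IsGaussianField.integral_eval_eq_zero {μ : Measure (FieldConfig E)} (hμ : IsGaussianField μ)
    (f : 𝓢(E, ℝ)) : ∫ ω, (fun (f : 𝓢(E, ℝ)) (ω : FieldConfig E) => ω f) f ω ∂μ = 0 :=
  (hμ.2 f).2

end Eval

/-! ### Additivity: smooth cutoffs around a sphere -/

section Cutoff

variable {E : Type*} [NormedAddCommGroup E] [NormedSpace ℝ E] [HasContDiffBump E]
  [FiniteDimensional ℝ E]

/-- Multiplying a real test function by a bump function. [folklore] -/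
theorem smulLeftCLM_bump_apply (χ : ContDiffBump (0 : E)) (w : 𝓢(E, ℝ)) (x : E) :
    SchwartzMap.smulLeftCLM ℝ (χ : E → ℝ) w x = χ x * w x := by
  rw [SchwartzMap.smulLeftCLM_apply_apply (χ.hasCompactSupport.hasTemperateGrowth χ.contDiff),
    smul_eq_mul]

omit [FiniteDimensional ℝ E] in
/-- The support of `χ w` lies in the closed ball of radius `rOut`. [folklore] -/
theorem tsupport_smulLeftCLM_bump_subset (χ : ContDiffBump (0 : E)) (w : 𝓢(E, ℝ)) :
    tsupport (SchwartzMap.smulLeftCLM ℝ (χ : E → ℝ) w : E → ℝ) ⊆ closedBall (0 : E) χ.rOut :=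
  ((SchwartzMap.tsupport_smulLeftCLM_subset (χ : E → ℝ) w).trans inter_subset_right).trans
    χ.tsupport_eq.le

omit [HasContDiffBump E] [FiniteDimensional ℝ E] in
/-- Points of the closed shell `r - δ ≤ ‖x‖ ≤ r + δ` (`0 ≤ δ < ε`, `δ < r`) lie in the open
`ε`-thickening of the sphere of radius `r` (radial projection onto the sphere). [folklore] -/
theorem mem_thickening_sphere_of_abs_norm_sub_le {r δ ε : ℝ} (hδr : δ < r) (hδε : δ < ε)
    {x : E} (h1 : r - δ ≤ ‖x‖) (h2 : ‖x‖ ≤ r + δ) : x ∈ thickening ε (sphere (0 : E) r) := by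
  have hx0 : 0 < ‖x‖ := lt_of_lt_of_le (by linarith) h1
  have hr : 0 < r := by
    have : 0 ≤ ‖x‖ - r + r := by linarith [norm_nonneg x]
    nlinarith [norm_nonneg x]
  rw [mem_thickening_iff]
  refine ⟨(r / ‖x‖) • x, ?_, ?_⟩
  · rw [mem_sphere_zero_iff_norm, norm_smul, Real.norm_eq_abs, abs_of_pos (div_pos hr hx0),
      div_mul_cancel₀ r hx0.ne']
  · rw [dist_eq_norm]
    have : x - (r / ‖x‖) • x = (1 - r / ‖x‖) • x := by rw [sub_smul, one_smul]
    rw [this, norm_smul, Real.norm_eq_abs]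
    have hcalc : |1 - r / ‖x‖| * ‖x‖ = |‖x‖ - r| := by
      rw [← abs_of_pos hx0, ← abs_mul, abs_of_pos hx0]
      congr 1
      field_simp
    rw [hcalc]
    rw [abs_sub_lt_iff]
    constructor <;> linarith

/-- **Additivity for the cover `E = B(0,r) ∪ (∂B)^ε ∪ B̄(0,r)ᶜ`** (Rozanov 1982, Ch. 2 §3.1
(3.1): `H(S' ∪ S'') = H(S') ∨ H(S'')` for generalized random functions, by smooth partitions of
the test functions).  For `0 < ε < r` every real test function `w` splits as `w = w₁ + w₂ + w₃`
with `tsupport w₁ ⊆ B(0, r)`, `tsupport w₂ ⊆ (∂B(0, r))^ε` and `tsupport w₃ ⊆ B̄(0, r)ᶜ`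
(`w₁ = χ₁ w`, `w₂ = (χ₂ - χ₁) w`, `w₃ = (1 - χ₂) w` for radial bumps `χ₁ = 1` on
`‖x‖ ≤ r - 2ε/3`, `= 0` off `‖x‖ < r - ε/3`, and `χ₂ = 1` on `‖x‖ ≤ r + ε/3`, `= 0` off
`‖x‖ < r + 2ε/3`). [cite: Rozanov1982, Ch. 2 §3.1 (3.1)] -/
theorem exists_schwartz_decomp_collar {r ε : ℝ} (hε : 0 < ε) (hεr : ε < r) (w : 𝓢(E, ℝ)) :
    ∃ w₁ w₂ w₃ : 𝓢(E, ℝ), w = w₁ + w₂ + w₃ ∧ tsupport (w₁ : E → ℝ) ⊆ ball (0 : E) r ∧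
      tsupport (w₂ : E → ℝ) ⊆ thickening ε (sphere (0 : E) r) ∧
      tsupport (w₃ : E → ℝ) ⊆ (closedBall (0 : E) r)ᶜ := by
  have hr : 0 < r := hε.trans hεr
  let χ₁ : ContDiffBump (0 : E) := ⟨r - 2 * ε / 3, r - ε / 3, by linarith, by linarith⟩
  let χ₂ : ContDiffBump (0 : E) := ⟨r + ε / 3, r + 2 * ε / 3, by linarith, by linarith⟩
  set m₁ : 𝓢(E, ℝ) := SchwartzMap.smulLeftCLM ℝ (χ₁ : E → ℝ) w with hm₁
  set m₂ : 𝓢(E, ℝ) := SchwartzMap.smulLeftCLM ℝ (χ₂ : E → ℝ) w with hm₂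
  have hm₁x : ∀ x, m₁ x = χ₁ x * w x := smulLeftCLM_bump_apply χ₁ w
  have hm₂x : ∀ x, m₂ x = χ₂ x * w x := smulLeftCLM_bump_apply χ₂ w
  refine ⟨m₁, m₂ - m₁, w - m₂, by abel, ?_, ?_, ?_⟩
  · -- `tsupport (χ₁ w) ⊆ B̄(0, r - ε/3) ⊆ B(0, r)`
    exact (tsupport_smulLeftCLM_bump_subset χ₁ w).trans (closedBall_subset_ball (by
      show r - ε / 3 < r; linarith))
  · -- `tsupport ((χ₂ - χ₁) w)` lies in the closed shell `r - 2ε/3 ≤ ‖x‖ ≤ r + 2ε/3`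
    have hsupp : Function.support ((m₂ - m₁ : 𝓢(E, ℝ)) : E → ℝ) ⊆
        {x | r - 2 * ε / 3 ≤ ‖x‖} ∩ {x | ‖x‖ ≤ r + 2 * ε / 3} := by
      intro x hx
      rw [Function.mem_support] at hx
      change m₂ x - m₁ x ≠ 0 at hx
      rw [hm₁x, hm₂x] at hx
      constructor
      · by_contra hlt
        rw [mem_setOf_eq, not_le] at hlt
        have h1 : χ₁ x = 1 := χ₁.one_of_mem_closedBall (by
          rw [mem_closedBall, dist_zero_right]; exact hlt.le)
        have h2 : χ₂ x = 1 := χ₂.one_of_mem_closedBall (by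
          rw [mem_closedBall, dist_zero_right]; show ‖x‖ ≤ r + ε / 3; linarith)
        exact hx (by rw [h1, h2, sub_self])
      · by_contra hlt
        rw [mem_setOf_eq, not_le] at hlt
        have h1 : χ₁ x = 0 := χ₁.zero_of_le_dist (by
          rw [dist_zero_right]; show r - ε / 3 ≤ ‖x‖; linarith)
        have h2 : χ₂ x = 0 := χ₂.zero_of_le_dist (by
          rw [dist_zero_right]; exact hlt.le)
        exact hx (by rw [h1, h2, zero_mul, sub_self])
    have hclosed : IsClosed ({x : E | r - 2 * ε / 3 ≤ ‖x‖} ∩ {x | ‖x‖ ≤ r + 2 * ε / 3}) :=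
      (isClosed_le continuous_const continuous_norm).inter
        (isClosed_le continuous_norm continuous_const)
    refine (closure_minimal hsupp hclosed).trans ?_
    rintro x ⟨h1, h2⟩
    exact mem_thickening_sphere_of_abs_norm_sub_le (δ := 2 * ε / 3) (by linarith) (by linarith)
      h1 h2
  · -- `tsupport ((1 - χ₂) w) ⊆ B(0, r + ε/3)ᶜ ⊆ B̄(0, r)ᶜ`
    have hsupp : Function.support ((w - m₂ : 𝓢(E, ℝ)) : E → ℝ) ⊆ (ball (0 : E) (r + ε / 3))ᶜ := by
      intro x hx
      rw [Function.mem_support] at hx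
      rw [mem_compl_iff]
      intro hxb
      refine hx ?_
      change w x - m₂ x = 0
      rw [hm₂x, χ₂.one_of_mem_closedBall (ball_subset_closedBall hxb), one_mul, sub_self]
    refine (closure_minimal hsupp isOpen_ball.isClosed_compl).trans ?_
    exact compl_subset_compl.2 (closedBall_subset_ball (by linarith))

end Cutoff

/-! ### The Gaussian space of a collar-Markov field splits -/

section Splitting

variable {E : Type*} [NormedAddCommGroup E] [InnerProductSpace ℝ E] [FiniteDimensional ℝ E]

/-- **Additivity of the Gaussian spaces**: for `0 < ε < r` the whole Gaussian space
`H(E) ⊆ L²(μ)` of a Gaussian field is contained in the closure of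
`H(B(0,r)) + H((∂B(0,r))^ε) + H(B̄(0,r)ᶜ)` (Rozanov Ch. 2 §3.1 (3.1)).
[cite: Rozanov1982, Ch. 2 §3.1 (3.1)] -/
theorem gaussianSpan_univ_le_closure_sup {μ : Measure (FieldConfig E)}
    (hX : IsGaussianProcess (fun (f : 𝓢(E, ℝ)) (ω : FieldConfig E) => ω f) μ) {r ε : ℝ}
    (hε : 0 < ε) (hεr : ε < r) :
    gaussianSpan hX univ ≤
      (gaussianSpan hX {f | tsupport f ⊆ ball (0 : E) r} ⊔
        gaussianSpan hX {f | tsupport f ⊆ thickening ε (sphere (0 : E) r)} ⊔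
        gaussianSpan hX {f | tsupport f ⊆ (closedBall (0 : E) r)ᶜ}).topologicalClosure := by
  refine gaussianSpan_le hX (Submodule.isClosed_topologicalClosure _) fun w => ?_
  refine Submodule.le_topologicalClosure _ ?_
  obtain ⟨w₁, w₂, w₃, hsum, h₁, h₂, h₃⟩ := exists_schwartz_decomp_collar hε hεr (w : 𝓢(E, ℝ))
  have heq : (memLp_two_of_isGaussianProcess hX (w : 𝓢(E, ℝ))).toLp
        ((fun (f : 𝓢(E, ℝ)) (ω : FieldConfig E) => ω f) w) =
      (memLp_two_of_isGaussianProcess hX w₁).toLp (fun ω : FieldConfig E => ω w₁) +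
      (memLp_two_of_isGaussianProcess hX w₂).toLp (fun ω : FieldConfig E => ω w₂) +
      (memLp_two_of_isGaussianProcess hX w₃).toLp (fun ω : FieldConfig E => ω w₃) := by
    refine Lp.ext ?_
    filter_upwards [(memLp_two_of_isGaussianProcess hX (w : 𝓢(E, ℝ))).coeFn_toLp,
      (memLp_two_of_isGaussianProcess hX w₁).coeFn_toLp,
      (memLp_two_of_isGaussianProcess hX w₂).coeFn_toLp,
      (memLp_two_of_isGaussianProcess hX w₃).coeFn_toLp,
      Lp.coeFn_add ((memLp_two_of_isGaussianProcess hX w₁).toLp (fun ω : FieldConfig E => ω w₁) +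
          (memLp_two_of_isGaussianProcess hX w₂).toLp (fun ω : FieldConfig E => ω w₂))
        ((memLp_two_of_isGaussianProcess hX w₃).toLp (fun ω : FieldConfig E => ω w₃)),
      Lp.coeFn_add ((memLp_two_of_isGaussianProcess hX w₁).toLp (fun ω : FieldConfig E => ω w₁))
        ((memLp_two_of_isGaussianProcess hX w₂).toLp (fun ω : FieldConfig E => ω w₂))]
      with ω h0 h1 h2 h3 h4 h5
    rw [h0, h4, Pi.add_apply, h5, Pi.add_apply, h1, h2, h3]
    show ω (w : 𝓢(E, ℝ)) = ω w₁ + ω w₂ + ω w₃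
    rw [hsum, map_add, map_add]
  rw [heq]
  exact Submodule.add_mem _
    (Submodule.add_mem _
      (Submodule.mem_sup_left (Submodule.mem_sup_left (toLp_mem_gaussianSpan hX ⟨w₁, h₁⟩)))
      (Submodule.mem_sup_left (Submodule.mem_sup_right (toLp_mem_gaussianSpan hX ⟨w₂, h₂⟩))))
    (Submodule.mem_sup_right (toLp_mem_gaussianSpan hX ⟨w₃, h₃⟩))

/-- **Rozanov's (3.10) for the ball, from the collar Markov property of the σ-algebras.**  Let
`μ` be a centred Gaussian law on `FieldConfig E` and `0 < ε < r`, and suppose the collar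
σ-algebra `𝒜((∂B(0,r))^ε)` splits `𝒜(B(0,r))` and `𝒜(B̄(0,r)ᶜ)` (`CondIndepCondExp`; the
condition inside `IsCollarMarkovAt μ (ball 0 r)`).  Then, in the Gaussian space
`H(E) = gaussianSpan _ univ ⊆ L²(μ)` of the evaluation process: if `x ∈ H(E)` is orthogonal to
`H((∂B)^ε)` and to `H(B̄ᶜ)`, and `y` is orthogonal to `H((∂B)^ε)` and to `H(B)`, then `⟪x, y⟫ = 0`
(*"`H(S₁ ∪ Γ^ε)^⊥ ⊥ H(S₂ ∪ Γ^ε)^⊥` because `H(S₁ ∪ Γ^ε) ∨ H(S₂ ∪ Γ^ε) = H(T)`"*).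
[cite: Rozanov1982, Ch. 2 §3.3 (3.10)] -/
theorem inner_eq_zero_of_collar_condIndepCondExp {μ : Measure (FieldConfig E)}
    [IsProbabilityMeasure μ] (hμ : IsGaussianField μ) {r ε : ℝ} (hε : 0 < ε) (hεr : ε < r)
    (h : CondIndepCondExp (fieldSigma (thickening ε (sphere (0 : E) r))) (fieldSigma (ball (0 : E) r))
      (fieldSigma (closedBall (0 : E) r)ᶜ) μ)
    {x y : Lp ℝ 2 μ} (hx : x ∈ gaussianSpan hμ.isGaussianProcess_eval univ)
    (hx' : x ∈ (gaussianSpan hμ.isGaussianProcess_eval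
      {f | tsupport f ⊆ thickening ε (sphere (0 : E) r)})ᗮ)
    (hx₂ : x ∈ (gaussianSpan hμ.isGaussianProcess_eval {f | tsupport f ⊆ (closedBall (0 : E) r)ᶜ})ᗮ)
    (hy' : y ∈ (gaussianSpan hμ.isGaussianProcess_eval
      {f | tsupport f ⊆ thickening ε (sphere (0 : E) r)})ᗮ)
    (hy₁ : y ∈ (gaussianSpan hμ.isGaussianProcess_eval {f | tsupport f ⊆ ball (0 : E) r})ᗮ) :
    ⟪x, y⟫_ℝ = 0 :=
  inner_eq_zero_of_condIndepCondExp_of_mem_orthogonal hμ.isGaussianProcess_eval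
    measurable_eval_process hμ.integral_eval_eq_zero
    (J' := {f | tsupport f ⊆ thickening ε (sphere (0 : E) r)})
    (J₁ := {f | tsupport f ⊆ ball (0 : E) r}) (J₂ := {f | tsupport f ⊆ (closedBall (0 : E) r)ᶜ}) h
    (gaussianSpan_univ_le_closure_sup hμ.isGaussianProcess_eval hε hεr hx) hx' hx₂ hy' hy₁

end Splitting

end Literature.MathematicalPhysics.QuantumLattice
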